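import Mathlib

/-! # Brick `stub_minkowskiSW` — crux `TwoProducts` (stmt-ValiantsHypothesis-5906), line `corner-log-linearization`

SOUTH-WEST VERTICES OF A MINKOWSKI SUM (lead c7, Framework VII-D; pure planar geometry).  For nonempty finite sets
`A, C ⊆ ℕ²`, the south-west vertices (strict minimisers of an integer weight with both entries positive) of the sumset
`A + C` number at most `#swVert A + #swVert C − 1`.  A strict minimiser of `A + C` for `w` is `a_w + c_w` with `a_w, c_w` the
strict `w`-minimisers of `A`, `C`; as the direction of `w` turns, both move monotonically in the `x`-coordinate (exchange
inequality), so the realised pairs form a chain in `swVert A × swVert C` for the product order, and a chain in a `p × q` grid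
has at most `p + q − 1` elements. [folklore] -/

set_option linter.dupNamespace false -- single-conjunct summit: `ValiantsHypothesis.ValiantsHypothesis`

namespace Summit.ValiantsHypothesis.ValiantsHypothesis.Theorems.TwoProducts.MinkowskiSW

open scoped BigOperators

/-- Exchange inequality: strict `w`- and `w'`-minimisers of the same set move monotonically in `x` with the direction of the
weight: `(w₀w'₁ − w₁w'₀)·(a₀ − a'₀) ≤ 0`. [folklore] -/
theorem exchange {S : Finset (Fin 2 →₀ ℕ)} {w w' : Fin 2 → ℤ} (hw1 : 0 < w 1) (hw'1 : 0 < w' 1)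
    {a a' : Fin 2 →₀ ℕ} (ha' : a' ∈ S) (ha : a ∈ S)
    (hmin : ∀ e ∈ S, e ≠ a → w 0 * (a 0 : ℤ) + w 1 * (a 1 : ℤ) < w 0 * (e 0 : ℤ) + w 1 * (e 1 : ℤ))
    (hmin' : ∀ e ∈ S, e ≠ a' → w' 0 * (a' 0 : ℤ) + w' 1 * (a' 1 : ℤ) < w' 0 * (e 0 : ℤ) + w' 1 * (e 1 : ℤ)) :
    (w 0 * w' 1 - w 1 * w' 0) * ((a 0 : ℤ) - (a' 0 : ℤ)) ≤ 0 := by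
  by_cases h : a = a'
  · subst h; simp
  have h1 : w 0 * (a 0 : ℤ) + w 1 * (a 1 : ℤ) ≤ w 0 * (a' 0 : ℤ) + w 1 * (a' 1 : ℤ) := (hmin a' ha' (Ne.symm h)).le
  have h2 : w' 0 * (a' 0 : ℤ) + w' 1 * (a' 1 : ℤ) ≤ w' 0 * (a 0 : ℤ) + w' 1 * (a 1 : ℤ) := (hmin' a ha h).le
  nlinarith [mul_le_mul_of_nonneg_left h1 hw'1.le, mul_le_mul_of_nonneg_left h2 hw1.le]

/-- Parallel positive weights have the same strict minimisers. [folklore] -/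
theorem eq_of_parallel {S : Finset (Fin 2 →₀ ℕ)} {w w' : Fin 2 → ℤ} (hw1 : 0 < w 1) (hw'1 : 0 < w' 1)
    (hpar : w 0 * w' 1 - w 1 * w' 0 = 0) {a a' : Fin 2 →₀ ℕ} (ha' : a' ∈ S) (ha : a ∈ S)
    (hmin : ∀ e ∈ S, e ≠ a → w 0 * (a 0 : ℤ) + w 1 * (a 1 : ℤ) < w 0 * (e 0 : ℤ) + w 1 * (e 1 : ℤ))
    (hmin' : ∀ e ∈ S, e ≠ a' → w' 0 * (a' 0 : ℤ) + w' 1 * (a' 1 : ℤ) < w' 0 * (e 0 : ℤ) + w' 1 * (e 1 : ℤ)) :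
    a = a' := by
  by_contra h
  have h1 := hmin a' ha' (Ne.symm h)
  have h2 := hmin' a ha h
  -- `w' 1 • (w·x) = w 1 • (w'·x)` for parallel weights
  have key : ∀ x : Fin 2 →₀ ℕ, w' 1 * (w 0 * (x 0 : ℤ) + w 1 * (x 1 : ℤ)) = w 1 * (w' 0 * (x 0 : ℤ) + w' 1 * (x 1 : ℤ)) := by
    intro x; linear_combination (x 0 : ℤ) * hpar
  have h1' := mul_lt_mul_of_pos_left h1 hw'1
  rw [key a, key a'] at h1'
  have h2' := mul_lt_mul_of_pos_left h2 hw1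
  exact lt_asymm h1' h2'

/-- Distinct strict minimisers (for positive weights) of one set have distinct `x`-coordinates. [folklore] -/
theorem apply_zero_ne {S : Finset (Fin 2 →₀ ℕ)} {w w' : Fin 2 → ℤ} (hw0 : 0 < w 0) (hw1 : 0 < w 1)
    (hw'0 : 0 < w' 0) (hw'1 : 0 < w' 1) {a a' : Fin 2 →₀ ℕ} (ha' : a' ∈ S) (ha : a ∈ S)
    (hmin : ∀ e ∈ S, e ≠ a → w 0 * (a 0 : ℤ) + w 1 * (a 1 : ℤ) < w 0 * (e 0 : ℤ) + w 1 * (e 1 : ℤ))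
    (hmin' : ∀ e ∈ S, e ≠ a' → w' 0 * (a' 0 : ℤ) + w' 1 * (a' 1 : ℤ) < w' 0 * (e 0 : ℤ) + w' 1 * (e 1 : ℤ))
    (hne : a ≠ a') : a 0 ≠ a' 0 := by
  intro hx
  have hy : a 1 ≠ a' 1 := by
    intro hy; apply hne; ext i; fin_cases i <;> assumption
  rcases lt_or_gt_of_ne hy with hlt | hlt
  · -- `a` is lighter than `a'` for every positive weight
    have := hmin' a ha hne
    have hx' : (a 0 : ℤ) = a' 0 := by exact_mod_cast hx
    have hlt' : (a 1 : ℤ) < a' 1 := by exact_mod_cast hlt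
    nlinarith
  · have := hmin a' ha' (Ne.symm hne)
    have hx' : (a 0 : ℤ) = a' 0 := by exact_mod_cast hx
    have hlt' : (a' 1 : ℤ) < a 1 := by exact_mod_cast hlt
    nlinarith

/-- Decomposition: a strict minimiser of `A + C` is the sum of strict minimisers of `A` and of `C` for the same weight.
[folklore] -/
theorem exists_split {A C : Finset (Fin 2 →₀ ℕ)} (hA : A.Nonempty) (hC : C.Nonempty) {w : Fin 2 → ℤ}
    {e : Fin 2 →₀ ℕ} (he : e ∈ Finset.image₂ (· + ·) A C)
    (hmin : ∀ e' ∈ Finset.image₂ (· + ·) A C, e' ≠ e →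
      w 0 * (e 0 : ℤ) + w 1 * (e 1 : ℤ) < w 0 * (e' 0 : ℤ) + w 1 * (e' 1 : ℤ)) :
    ∃ a ∈ A, ∃ c ∈ C, e = a + c ∧
      (∀ x ∈ A, x ≠ a → w 0 * (a 0 : ℤ) + w 1 * (a 1 : ℤ) < w 0 * (x 0 : ℤ) + w 1 * (x 1 : ℤ)) ∧
      (∀ x ∈ C, x ≠ c → w 0 * (c 0 : ℤ) + w 1 * (c 1 : ℤ) < w 0 * (x 0 : ℤ) + w 1 * (x 1 : ℤ)) := by
  classical
  set f : (Fin 2 →₀ ℕ) → ℤ := fun x => w 0 * (x 0 : ℤ) + w 1 * (x 1 : ℤ) with hf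
  have hfadd : ∀ x y : Fin 2 →₀ ℕ, f (x + y) = f x + f y := by
    intro x y; simp only [hf, Finsupp.coe_add, Pi.add_apply, Nat.cast_add]; ring
  obtain ⟨a, ha, hale⟩ := Finset.exists_min_image A f hA
  obtain ⟨c, hc, hcle⟩ := Finset.exists_min_image C f hC
  have hac : a + c ∈ Finset.image₂ (· + ·) A C := Finset.mem_image₂_of_mem ha hc
  -- every point of `A + C` weighs at least `f a + f c`
  have hlow : ∀ e' ∈ Finset.image₂ (· + ·) A C, f a + f c ≤ f e' := by
    intro e' he'
    obtain ⟨x, hx, y, hy, rfl⟩ := Finset.mem_image₂.mp he'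
    rw [hfadd]; exact add_le_add (hale x hx) (hcle y hy)
  -- hence `e = a + c`
  have heac : e = a + c := by
    by_contra hne
    have h1 := hmin (a + c) hac (Ne.symm hne)
    have h2 := hlow e he
    change f e < f (a + c) at h1
    rw [hfadd] at h1
    linarith
  refine ⟨a, ha, c, hc, heac, ?_, ?_⟩
  · intro x hx hxa
    refine lt_of_le_of_ne (hale x hx) fun heq => hxa ?_
    -- `x + c` has the minimal weight, so equals `e = a + c`
    have hxc : x + c ∈ Finset.image₂ (· + ·) A C := Finset.mem_image₂_of_mem hx hc
    by_contra hxne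
    have hne : x + c ≠ e := by rw [heac]; intro h; exact hxne (add_right_cancel h)
    have h1 := hmin (x + c) hxc hne
    change f e < f (x + c) at h1
    rw [heac, hfadd, hfadd] at h1
    change f a = f x at heq
    linarith
  · intro y hy hyc
    refine lt_of_le_of_ne (hcle y hy) fun heq => hyc ?_
    have hay : a + y ∈ Finset.image₂ (· + ·) A C := Finset.mem_image₂_of_mem ha hy
    by_contra hyne
    have hne : a + y ≠ e := by rw [heac]; intro h; exact hyne (add_left_cancel h)
    have h1 := hmin (a + y) hay hne
    change f e < f (a + y) at h1
    rw [heac, hfadd, hfadd] at h1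
    change f c = f y at heq
    linarith

/-- A chain in a product of two finite sets of naturals (for the componentwise order) has at most `|P| + |Q| − 1` elements:
the rank-sum is injective on it. [folklore] -/
theorem card_chain_le (P Q : Finset ℕ) (Pr : Finset (ℕ × ℕ)) (hPr : ∀ z ∈ Pr, z.1 ∈ P ∧ z.2 ∈ Q)
    (hchain : ∀ z ∈ Pr, ∀ z' ∈ Pr, (z.1 ≤ z'.1 ∧ z.2 ≤ z'.2) ∨ (z'.1 ≤ z.1 ∧ z'.2 ≤ z.2)) (hne : Pr.Nonempty) :
    Pr.card + 1 ≤ P.card + Q.card := by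
  classical
  -- rank-sum map into `[2, |P| + |Q|]`
  set rk : ℕ × ℕ → ℕ := fun z => (P.filter (· ≤ z.1)).card + (Q.filter (· ≤ z.2)).card with hrk
  have hmono1 : ∀ {x y : ℕ}, x ∈ P → x ≤ y → (P.filter (· ≤ x)).card ≤ (P.filter (· ≤ y)).card := by
    intro x y _ hxy
    exact Finset.card_le_card (fun t ht => by
      rw [Finset.mem_filter] at ht ⊢; exact ⟨ht.1, ht.2.trans hxy⟩)
  have hmono2 : ∀ {x y : ℕ}, x ∈ Q → x ≤ y → (Q.filter (· ≤ x)).card ≤ (Q.filter (· ≤ y)).card := by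
    intro x y _ hxy
    exact Finset.card_le_card (fun t ht => by
      rw [Finset.mem_filter] at ht ⊢; exact ⟨ht.1, ht.2.trans hxy⟩)
  have hstrict1 : ∀ {x y : ℕ}, x ∈ P → y ∈ P → x < y → (P.filter (· ≤ x)).card < (P.filter (· ≤ y)).card := by
    intro x y _ hy hxy
    refine Finset.card_lt_card ⟨fun t ht => ?_, fun hsub => ?_⟩
    · rw [Finset.mem_filter] at ht ⊢; exact ⟨ht.1, ht.2.trans hxy.le⟩
    · have : y ∈ P.filter (· ≤ x) := hsub (Finset.mem_filter.mpr ⟨hy, le_rfl⟩)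
      rw [Finset.mem_filter] at this; omega
  have hstrict2 : ∀ {x y : ℕ}, x ∈ Q → y ∈ Q → x < y → (Q.filter (· ≤ x)).card < (Q.filter (· ≤ y)).card := by
    intro x y _ hy hxy
    refine Finset.card_lt_card ⟨fun t ht => ?_, fun hsub => ?_⟩
    · rw [Finset.mem_filter] at ht ⊢; exact ⟨ht.1, ht.2.trans hxy.le⟩
    · have : y ∈ Q.filter (· ≤ x) := hsub (Finset.mem_filter.mpr ⟨hy, le_rfl⟩)
      rw [Finset.mem_filter] at this; omega
  -- injectivity of `rk` on the chain
  have hinj : Set.InjOn rk ↑Pr := by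
    intro z hz z' hz' hzz
    rcases hchain z hz z' hz' with ⟨h1, h2⟩ | ⟨h1, h2⟩
    · rcases h1.lt_or_eq with hl | he1
      · have := hstrict1 (hPr z hz).1 (hPr z' hz').1 hl
        have := hmono2 (hPr z hz).2 h2
        simp only [hrk] at hzz; omega
      · rcases h2.lt_or_eq with hl2 | he2
        · have := hstrict2 (hPr z hz).2 (hPr z' hz').2 hl2
          have := hmono1 (hPr z hz).1 h1
          simp only [hrk] at hzz; omega
        · exact Prod.ext he1 he2
    · rcases h1.lt_or_eq with hl | he1
      · have := hstrict1 (hPr z' hz').1 (hPr z hz).1 hl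
        have := hmono2 (hPr z' hz').2 h2
        simp only [hrk] at hzz; omega
      · rcases h2.lt_or_eq with hl2 | he2
        · have := hstrict2 (hPr z' hz').2 (hPr z hz).2 hl2
          have := hmono1 (hPr z' hz').1 h1
          simp only [hrk] at hzz; omega
        · exact (Prod.ext he1 he2).symm
  -- the image lies in `[2, |P| + |Q|]`
  have himage : Pr.image rk ⊆ Finset.Icc 2 (P.card + Q.card) := by
    intro m hm
    obtain ⟨z, hz, rfl⟩ := Finset.mem_image.mp hm
    rw [Finset.mem_Icc]
    constructor
    · have h1 : 1 ≤ (P.filter (· ≤ z.1)).card :=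
        Finset.card_pos.mpr ⟨z.1, Finset.mem_filter.mpr ⟨(hPr z hz).1, le_rfl⟩⟩
      have h2 : 1 ≤ (Q.filter (· ≤ z.2)).card :=
        Finset.card_pos.mpr ⟨z.2, Finset.mem_filter.mpr ⟨(hPr z hz).2, le_rfl⟩⟩
      simp only [hrk]; omega
    · exact add_le_add (Finset.card_filter_le _ _) (Finset.card_filter_le _ _)
  have hcard := Finset.card_le_card himage
  rw [Finset.card_image_of_injOn hinj, Nat.card_Icc] at hcard
  have hpos : 0 < Pr.card := Finset.card_pos.mpr hne
  omega

/-- **BRICK `stub_minkowskiSW`** (registered signature): south-west vertices of a Minkowski sum of two nonempty finite planar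
sets. [folklore] -/
theorem stub_minkowskiSW : ∀ (A C : Finset (Fin 2 →₀ ℕ)), A.Nonempty → C.Nonempty →
    {e : Fin 2 →₀ ℕ | ∃ w : Fin 2 → ℤ, 0 < w 0 ∧ 0 < w 1 ∧ e ∈ Finset.image₂ (· + ·) A C ∧
        ∀ e' ∈ Finset.image₂ (· + ·) A C, e' ≠ e →
          w 0 * (e 0 : ℤ) + w 1 * (e 1 : ℤ) < w 0 * (e' 0 : ℤ) + w 1 * (e' 1 : ℤ)}.ncard + 1 ≤
      {e : Fin 2 →₀ ℕ | ∃ w : Fin 2 → ℤ, 0 < w 0 ∧ 0 < w 1 ∧ e ∈ A ∧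
        ∀ e' ∈ A, e' ≠ e → w 0 * (e 0 : ℤ) + w 1 * (e 1 : ℤ) < w 0 * (e' 0 : ℤ) + w 1 * (e' 1 : ℤ)}.ncard +
      {e : Fin 2 →₀ ℕ | ∃ w : Fin 2 → ℤ, 0 < w 0 ∧ 0 < w 1 ∧ e ∈ C ∧
        ∀ e' ∈ C, e' ≠ e → w 0 * (e 0 : ℤ) + w 1 * (e 1 : ℤ) < w 0 * (e' 0 : ℤ) + w 1 * (e' 1 : ℤ)}.ncard := by
  classical
  intro A C hA hC
  set SAC := {e : Fin 2 →₀ ℕ | ∃ w : Fin 2 → ℤ, 0 < w 0 ∧ 0 < w 1 ∧ e ∈ Finset.image₂ (· + ·) A C ∧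
        ∀ e' ∈ Finset.image₂ (· + ·) A C, e' ≠ e →
          w 0 * (e 0 : ℤ) + w 1 * (e 1 : ℤ) < w 0 * (e' 0 : ℤ) + w 1 * (e' 1 : ℤ)} with hSAC
  set SA := {e : Fin 2 →₀ ℕ | ∃ w : Fin 2 → ℤ, 0 < w 0 ∧ 0 < w 1 ∧ e ∈ A ∧
        ∀ e' ∈ A, e' ≠ e → w 0 * (e 0 : ℤ) + w 1 * (e 1 : ℤ) < w 0 * (e' 0 : ℤ) + w 1 * (e' 1 : ℤ)} with hSA
  set SC := {e : Fin 2 →₀ ℕ | ∃ w : Fin 2 → ℤ, 0 < w 0 ∧ 0 < w 1 ∧ e ∈ C ∧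
        ∀ e' ∈ C, e' ≠ e → w 0 * (e 0 : ℤ) + w 1 * (e 1 : ℤ) < w 0 * (e' 0 : ℤ) + w 1 * (e' 1 : ℤ)} with hSC
  have hfinAC : SAC.Finite := (Finset.finite_toSet _).subset (by rintro e ⟨w, -, -, he, -⟩; exact he)
  have hfinA : SA.Finite := (Finset.finite_toSet A).subset (by rintro e ⟨w, -, -, he, -⟩; exact he)
  have hfinC : SC.Finite := (Finset.finite_toSet C).subset (by rintro e ⟨w, -, -, he, -⟩; exact he)
  -- choose, for every vertex of `A + C`, an exposing weight and its split
  have hsplit : ∀ e ∈ SAC, ∃ w : Fin 2 → ℤ, 0 < w 0 ∧ 0 < w 1 ∧ ∃ a ∈ A, ∃ c ∈ C, e = a + c ∧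
      (∀ x ∈ A, x ≠ a → w 0 * (a 0 : ℤ) + w 1 * (a 1 : ℤ) < w 0 * (x 0 : ℤ) + w 1 * (x 1 : ℤ)) ∧
      (∀ x ∈ C, x ≠ c → w 0 * (c 0 : ℤ) + w 1 * (c 1 : ℤ) < w 0 * (x 0 : ℤ) + w 1 * (x 1 : ℤ)) := by
    rintro e ⟨w, hw0, hw1, he, hmin⟩
    exact ⟨w, hw0, hw1, exists_split hA hC he hmin⟩
  choose! W hW0 hW1 fa hfaA fc hfcC hefac hamin hcmin using hsplit
  -- the pair map `e ↦ (a_e 0, c_e 0)` is injective on `SAC` and lands in a chain of `SA₀ × SC₀`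
  set P : Finset ℕ := hfinA.toFinset.image (fun a => a 0) with hP
  set Q : Finset ℕ := hfinC.toFinset.image (fun c => c 0) with hQ
  set Pr : Finset (ℕ × ℕ) := hfinAC.toFinset.image (fun e => ((fa e) 0, (fc e) 0)) with hPrdef
  have hfaSA : ∀ e ∈ SAC, fa e ∈ SA := fun e he => ⟨W e, hW0 e he, hW1 e he, hfaA e he, hamin e he⟩
  have hfcSC : ∀ e ∈ SAC, fc e ∈ SC := fun e he => ⟨W e, hW0 e he, hW1 e he, hfcC e he, hcmin e he⟩
  -- injectivity: the abscissae of `a_e`, `c_e` determine `a_e`, `c_e` (vertices have distinct abscissae), hence `e`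
  have hinj : Set.InjOn (fun e => ((fa e) 0, (fc e) 0)) (hfinAC.toFinset : Set (Fin 2 →₀ ℕ)) := by
    intro e he e' he' hee
    rw [Finset.mem_coe, Set.Finite.mem_toFinset] at he he'
    simp only [Prod.mk.injEq] at hee
    have ha : fa e = fa e' := by
      by_contra hne
      exact apply_zero_ne (hW0 e he) (hW1 e he) (hW0 e' he') (hW1 e' he') (hfaA e' he') (hfaA e he)
        (hamin e he) (hamin e' he') hne hee.1
    have hc : fc e = fc e' := by
      by_contra hne
      exact apply_zero_ne (hW0 e he) (hW1 e he) (hW0 e' he') (hW1 e' he') (hfcC e' he') (hfcC e he)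
        (hcmin e he) (hcmin e' he') hne hee.2
    rw [hefac e he, hefac e' he', ha, hc]
  have hPrcard : Pr.card = hfinAC.toFinset.card := Finset.card_image_of_injOn hinj
  have hPrPQ : ∀ z ∈ Pr, z.1 ∈ P ∧ z.2 ∈ Q := by
    intro z hz
    obtain ⟨e, he, rfl⟩ := Finset.mem_image.mp hz
    rw [Set.Finite.mem_toFinset] at he
    exact ⟨Finset.mem_image.mpr ⟨fa e, (Set.Finite.mem_toFinset _).mpr (hfaSA e he), rfl⟩,
      Finset.mem_image.mpr ⟨fc e, (Set.Finite.mem_toFinset _).mpr (hfcSC e he), rfl⟩⟩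
  have hchain : ∀ z ∈ Pr, ∀ z' ∈ Pr, (z.1 ≤ z'.1 ∧ z.2 ≤ z'.2) ∨ (z'.1 ≤ z.1 ∧ z'.2 ≤ z.2) := by
    intro z hz z' hz'
    obtain ⟨e, he, rfl⟩ := Finset.mem_image.mp hz
    obtain ⟨e', he', rfl⟩ := Finset.mem_image.mp hz'
    rw [Set.Finite.mem_toFinset] at he he'
    have hxa := exchange (S := A) (hW1 e he) (hW1 e' he') (hfaA e' he') (hfaA e he) (hamin e he) (hamin e' he')
    have hxc := exchange (S := C) (hW1 e he) (hW1 e' he') (hfcC e' he') (hfcC e he) (hcmin e he) (hcmin e' he')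
    rcases lt_trichotomy (W e 0 * W e' 1 - W e 1 * W e' 0) 0 with hs | hs | hs
    · right
      constructor
      · have : ((fa e) 0 : ℤ) - (fa e') 0 ≥ 0 := by nlinarith
        exact_mod_cast (sub_nonneg.mp this)
      · have : ((fc e) 0 : ℤ) - (fc e') 0 ≥ 0 := by nlinarith
        exact_mod_cast (sub_nonneg.mp this)
    · have ha := eq_of_parallel (S := A) (hW1 e he) (hW1 e' he') hs (hfaA e' he') (hfaA e he) (hamin e he) (hamin e' he')
      have hc := eq_of_parallel (S := C) (hW1 e he) (hW1 e' he') hs (hfcC e' he') (hfcC e he) (hcmin e he) (hcmin e' he')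
      left; simp [ha, hc]
    · left
      constructor
      · have : ((fa e) 0 : ℤ) - (fa e') 0 ≤ 0 := by nlinarith
        exact_mod_cast (sub_nonpos.mp this)
      · have : ((fc e) 0 : ℤ) - (fc e') 0 ≤ 0 := by nlinarith
        exact_mod_cast (sub_nonpos.mp this)
  -- `P`, `Q` have the cardinalities of `SA`, `SC` (vertices have distinct abscissae)
  have hPcard : P.card = SA.ncard := by
    rw [Set.ncard_eq_toFinset_card _ hfinA, hP]
    refine Finset.card_image_of_injOn ?_
    intro a ha a' ha' h
    rw [Finset.mem_coe, Set.Finite.mem_toFinset] at ha ha'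
    obtain ⟨w, hw0, hw1, haA, hamin'⟩ := ha
    obtain ⟨w', hw'0, hw'1, ha'A, ha'min⟩ := ha'
    by_contra hne
    exact apply_zero_ne hw0 hw1 hw'0 hw'1 ha'A haA hamin' ha'min hne h
  have hQcard : Q.card = SC.ncard := by
    rw [Set.ncard_eq_toFinset_card _ hfinC, hQ]
    refine Finset.card_image_of_injOn ?_
    intro c hc c' hc' h
    rw [Finset.mem_coe, Set.Finite.mem_toFinset] at hc hc'
    obtain ⟨w, hw0, hw1, hcC, hcmin'⟩ := hc
    obtain ⟨w', hw'0, hw'1, hc'C, hc'min⟩ := hc'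
    by_contra hne
    exact apply_zero_ne hw0 hw1 hw'0 hw'1 hc'C hcC hcmin' hc'min hne h
  rw [Set.ncard_eq_toFinset_card _ hfinAC, ← hPrcard, ← hPcard, ← hQcard]
  by_cases hPrne : Pr.Nonempty
  · exact card_chain_le P Q Pr hPrPQ hchain hPrne
  · rw [Finset.not_nonempty_iff_eq_empty.mp hPrne, Finset.card_empty]
    -- `SA` is nonempty: the lexicographically least point of `A` is a vertex, so `P.card ≥ 1`
    have hPpos : 0 < P.card := by
      rw [hPcard]
      -- weight `(K, 1)` with `K` large exposes the point of `A` minimal for `K·x + y`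
      obtain ⟨K, hK⟩ : ∃ K : ℤ, ∀ q ∈ A, ((q 1 : ℕ) : ℤ) < K :=
        ⟨((A.sup fun q => q 1 : ℕ) : ℤ) + 1, fun q hq => by
          have : q 1 ≤ A.sup fun q => q 1 := Finset.le_sup (f := fun q : Fin 2 →₀ ℕ => q 1) hq
          exact_mod_cast Nat.lt_succ_of_le this⟩
      have hK1 : 0 < K := by
        obtain ⟨q, hq⟩ := hA
        exact lt_of_le_of_lt (by positivity) (hK q hq)
      set g : (Fin 2 →₀ ℕ) → ℤ := fun q => K * (q 0 : ℤ) + (q 1 : ℤ) with hg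
      obtain ⟨a, ha, hale⟩ := Finset.exists_min_image A g hA
      refine Set.ncard_pos hfinA |>.mpr ⟨a, ⟨fun i => if i = 0 then K else 1, by simp [hK1], by simp, ha, ?_⟩⟩
      intro e' he' hne
      have hle := hale e' he'
      simp only [Fin.isValue, ↓reduceIte, one_ne_zero, one_mul]
      refine lt_of_le_of_ne hle fun heq => hne ?_
      -- `g` is injective on `A` (second coordinates below `K`)
      have heq' : K * (a 0 : ℤ) + (a 1 : ℤ) = K * (e' 0 : ℤ) + (e' 1 : ℤ) := heq
      have h0 : (a 0 : ℤ) = e' 0 := by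
        by_contra hne0
        have hK' := hK e' he'
        have hKa := hK a ha
        have ha1 : (0 : ℤ) ≤ (a 1 : ℕ) := by positivity
        have he1 : (0 : ℤ) ≤ (e' 1 : ℕ) := by positivity
        rcases lt_or_gt_of_ne hne0 with hlt | hlt
        · have : K * (a 0 : ℤ) + K ≤ K * (e' 0 : ℤ) := by nlinarith
          linarith
        · have : K * (e' 0 : ℤ) + K ≤ K * (a 0 : ℤ) := by nlinarith
          linarith
      have h1 : (a 1 : ℤ) = e' 1 := by rw [h0] at heq'; linarith
      ext i; fin_cases i
      · exact_mod_cast h0.symm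
      · exact_mod_cast h1.symm
    omega

end Summit.ValiantsHypothesis.ValiantsHypothesis.Theorems.TwoProducts.MinkowskiSW
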